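import Summits.ResolutionOfSingularities.ResolutionOfSingularities.Theorems.HilbertSamuelEliminationSigmaMaxModificationsCorridor3CPFrameLegality
import Summits.ResolutionOfSingularities.ResolutionOfSingularities.Theorems.HilbertSamuelEliminationSigmaMaxModificationsCorridor3CPFramePropagationChain
import Summits.ResolutionOfSingularities.ResolutionOfSingularities.Theorems.HilbertSamuelEliminationSigmaMaxModificationsCorridor3CPFrameCurveGermTransfer
import Literature.RingTheory.HilbertSamuel.NormalFlatnessBaseChangeProof
import Literature.AlgebraicGeometry.Resolution.PermissibleCentres
import HarnessLib

/-!
# [OURS · L1 W4.2] D18 G7, SCHEME SIDE — legality of the read centre from its PERMISSIBILITY at `x_n`, through the CP frame; the chain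
# theorem `exists_isCPFrame_of_reaches` with its binder REDUCED to «reading + permissibility»
# (cell res-hironaka, LADDER-RESOLUTION rung L; slot W4.2, crux chain w42 `SigmaMaxModificationsCorridor3` stmt-ResolutionOfSingularities-19249;
# `--supports stmt-ResolutionOfSingularities-19249 --as helper`; res-L1-w42-plan-1 RULING v3.14-42 (KG)(2); hand res-D-pv-060 (gen 8), on top of
# `…CPFrameLegality` (G7, algebra) and res-D-brk-3's `…CPFramePropagationChain` (p548461))

SCHEME-SIDE BOOKKEEPING (universe `0`, as `IsCPFrame`), 0 `def`s, every declaration PROVED; OURS; NOT a statement of Hironaka's manuscript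
[Hironaka2017] nor of [CossartJannsenSaito2020]/[CossartPiltant2019]. AI-written, weaker than expert review.

* **`IsCPFrame.coeff_mem_pow_of_isPermissibleAt`** — a CP frame `(R, u, h, φ)` of the stage with `δ ≥ 1`, a centre `C` PERMISSIBLE at `x_n`
  (tree `IdealSheafData.IsPermissibleAt`, CJS Def. 3.1 (2)) READ as `(𝓘_{C,x_n})·B = ((u_T) + (X))/(h)` with `h(0) ∈ (u_T)`: then
  `∀ i ∈ Icc 1 m, h.coeff (m − i) ∈ (u_T)^i`. Transport: along the flat local `φ` with `𝔪 ↦ 𝔪`, `B/𝓘B` is regular (tree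
  `Helpers.isRegularLocalRing_quotient_map_of_flat`, Matsumura 23.7) and `𝓘B` is normally flat (CJS Thm. 3.2 (3), tree
  `Ideal.IsNormallyFlat.map_of_flat`); then G7 `coeff_mem_pow_of_isNormallyFlat_of_map_eq`.
* **`exists_isCPFrame_of_reaches_of_reading`** — `Moving.exists_isCPFrame_of_reaches` with the binder `hread` REPLACED by: (a) `hperm` — every
  canonical centre at a reached stage is permissible at the marked point (the chain's centre package, CJS Thm. 3.3 / Lemma 5.34 (3)); (b)
  `hadapt` — the ADAPTED READING ONLY: from `H(s)` some CP frame with `δ ≥ 1` reads `C` as `V(X, u_T)` with `h(0) ∈ (u_T)` (no legality clause —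
  that is now a theorem). What remains open after this file is exactly the EXISTENCE of the adapted reading (G8 E-adapted propagation + the
  re-preparation `X ↦ X − θ`; CP 2019 Prop. 2.7 ¶1).

References: CJS LNM 2270 Def. 3.1, Thm. 3.2 (3), Thm. 3.3 [CossartJannsenSaito2020]; CP 2019 Prop. 2.5–2.7 [CossartPiltant2019]; Matsumura
Thm. 23.7 [Matsumura1987].
-/

noncomputable section

set_option linter.dupNamespace false

open CategoryTheory AlgebraicGeometry TopologicalSpace IsLocalRing Polynomial
open Literature.AlgebraicGeometry.Resolution Literature.RingTheory.HilbertSamuel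
open Summit.ResolutionOfSingularities.ResolutionOfSingularities.Theorems.CampaignW42
open Summit.ResolutionOfSingularities.ResolutionOfSingularities.Theorems.SigmaMaxModificationsCorridor3.Helpers

namespace Summit.ResolutionOfSingularities.ResolutionOfSingularities.Theorems.SigmaMaxModificationsCorridor3.Moving

/-- [OURS · L1 W4.2] **D18 G7 through the frame: a permissible centre read as `V(X, u_T)` in a CP frame with `δ ≥ 1` is read LEGALLY.**
`(R, u, h, φ)` a CP frame of the marked stage (`IsCPFrame`), `coeff_i h ∈ 𝔪_R^{m−i}`, `C` permissible at `x_n`, `(𝓘_{C,x_n})·B =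
((u_T)·R[X] + (X))·B` and `h(0) ∈ (u_T)`; then `h.coeff (m − i) ∈ (u_T)^i` for `1 ≤ i ≤ m`.
[cite: CossartJannsenSaito2020, Def. 3.1, Thm. 3.2 (3), Thm. 3.3] [cite: CossartPiltant2019, Prop. 2.5–2.7 (arXiv v1 pp. 13–14)] -/
theorem IsCPFrame.coeff_mem_pow_of_isPermissibleAt {s : MarkedStage.{0}} {R : Type} [CommRing R] [IsLocalRing R] {u : Fin 3 → R}
    {h : R[X]} {φ : (s.W.presheaf.stalk s.pt : Type) →+* R[X] ⧸ Ideal.span {h}} (hF : IsCPFrame s R u h φ)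
    (hco : ∀ i < h.natDegree, h.coeff i ∈ maximalIdeal R ^ (h.natDegree - i))
    (C : s.W.IdealSheafData) (hperm : IdealSheafData.IsPermissibleAt C s.pt) (T : Finset (Fin 3))
    (hJ : (stalkIdeal C s.pt).map φ =
      ((Ideal.span (u '' ↑T)).map (Polynomial.C : R →+* R[X]) ⊔ Ideal.span {X}).map (Ideal.Quotient.mk (Ideal.span {h})))
    (h0 : h.coeff 0 ∈ Ideal.span (u '' ↑T)) :
    ∀ i ∈ Finset.Icc 1 h.natDegree, h.coeff (h.natDegree - i) ∈ Ideal.span (u '' ↑T) ^ i := by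
  have hm : 0 < h.natDegree := hF.natDegree_pos
  obtain ⟨hR, hloc, hdim, hu, hmon, hφl, hflat, hmap, -, -⟩ := hF
  haveI := hR
  haveI : IsLocalRing (AdjoinRoot h) := hloc
  haveI : IsLocallyNoetherian s.W := s.ln
  letI algφ : Algebra (s.W.presheaf.stalk s.pt : Type) (R[X] ⧸ Ideal.span {h}) := φ.toAlgebra
  haveI : Module.Flat (s.W.presheaf.stalk s.pt : Type) (R[X] ⧸ Ideal.span {h}) := hflat
  haveI : IsLocalHom (algebraMap (s.W.presheaf.stalk s.pt : Type) (R[X] ⧸ Ideal.span {h})) := hφl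
  set I : Ideal (s.W.presheaf.stalk s.pt : Type) := stalkIdeal C s.pt with hI
  have hpermI : I.IsPermissible := hperm
  haveI : IsRegularLocalRing ((s.W.presheaf.stalk s.pt : Type) ⧸ I) := hpermI.isRegularLocalRing
  -- normal flatness ascends along the flat `φ`
  have hNF : (I.map φ).IsNormallyFlat := hpermI.isNormallyFlat.map_of_flat (B := R[X] ⧸ Ideal.span {h})
  -- `B/𝓘B` is regular
  obtain ⟨hregP, -⟩ := isRegularLocalRing_quotient_map_of_flat (O := (s.W.presheaf.stalk s.pt : Type)) (B := R[X] ⧸ Ideal.span {h})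
    hmap I hpermI.ne_top
  -- instances at the `AdjoinRoot h` types of the algebra file (`AdjoinRoot h` is `R[X] ⧸ (h)` by definition)
  haveI hreg' : IsRegularLocalRing (AdjoinRoot h ⧸ (I.map φ : Ideal (AdjoinRoot h))) := hregP
  haveI hdom : IsDomain (AdjoinRoot h ⧸ (I.map φ : Ideal (AdjoinRoot h))) := isDomain_of_isRegularLocalRing _
  haveI : (I.map φ : Ideal (AdjoinRoot h)).IsPrime := (Ideal.Quotient.isDomain_iff_prime _).mp hdom
  exact coeff_mem_pow_of_isNormallyFlat_of_map_eq hdim hu hmon hm hco T h0 (I.map φ : Ideal (AdjoinRoot h)) hNF hJ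

/-- [OURS · L1 W4.2] **D18 (i) along the chain, binder reduced to «permissibility + adapted reading».** As
`Moving.exists_isCPFrame_of_reaches` (p548461), with `hread` replaced by `hperm` (canonical centres are permissible at the marked point) and
`hadapt` (from `H(s)`, SOME CP frame with `δ ≥ 1` reads the centre as `V(X, u_T)` with `h(0) ∈ (u_T)`); legality is supplied by
`IsCPFrame.coeff_mem_pow_of_isPermissibleAt`. CONCLUSION: `H(s)` at every reached stage.
[cite: CossartJannsenSaito2020, Def. 3.1, Thm. 3.3] [cite: CossartPiltant2019, Prop. 2.7 (arXiv v1 p. 14)] -/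
theorem exists_isCPFrame_of_reaches_of_reading {p : ℕ} {R₀ : ∀ S : Scheme.{0}, CentreSeq S → Prop}
    (hRf : OracleFunctional R₀) (hRa : OracleAdmissible R₀) {ν : ℕ → ℕ} {X₀ : Scheme.{0}} [IsLocallyNoetherian X₀] {x : X₀}
    (hX : IsMaximalOrigin p 3 ν X₀ x)
    (hperm : ∀ s : MarkedStage.{0}, Reaches R₀ 3 ν (MarkedStage.init X₀ x) s →
      ∀ (C : s.W.IdealSheafData) (P' : Option (Pending (blowup C))), IsCanonicalStep R₀ 3 ν s.L s.P C P' →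
        IdealSheafData.IsPermissibleAt C s.pt)
    (hadapt : ∀ s : MarkedStage.{0}, Reaches R₀ 3 ν (MarkedStage.init X₀ x) s →
      ∀ (C : s.W.IdealSheafData) (P' : Option (Pending (blowup C))), IsCanonicalStep R₀ 3 ν s.L s.P C P' →
      (∃ (R : Type) (_ : CommRing R) (_ : IsLocalRing R) (u : Fin 3 → R) (h : R[X])
        (φ : (s.W.presheaf.stalk s.pt : Type) →+* R[X] ⧸ Ideal.span {h}),
        IsCPFrame s R u h φ ∧ IsAdicComplete (maximalIdeal R) R ∧ ∀ i < h.natDegree, h.coeff i ∈ maximalIdeal R ^ (h.natDegree - i)) →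
      ∃ (R₁ : Type) (_ : CommRing R₁) (_ : IsLocalRing R₁) (u₁ : Fin 3 → R₁) (h₁ : R₁[X])
        (φ₁ : (s.W.presheaf.stalk s.pt : Type) →+* R₁[X] ⧸ Ideal.span {h₁}) (T : Finset (Fin 3)),
        IsCPFrame s R₁ u₁ h₁ φ₁ ∧ (∀ i < h₁.natDegree, h₁.coeff i ∈ maximalIdeal R₁ ^ (h₁.natDegree - i)) ∧
        (stalkIdeal C s.pt).map φ₁ =
          ((Ideal.span (u₁ '' ↑T)).map (Polynomial.C : R₁ →+* R₁[X]) ⊔ Ideal.span {X}).map (Ideal.Quotient.mk (Ideal.span {h₁})) ∧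
        h₁.coeff 0 ∈ Ideal.span (u₁ '' ↑T))
    (h0 : ∃ (R : Type) (_ : CommRing R) (_ : IsLocalRing R) (u : Fin 3 → R) (h : R[X])
      (φ : ((MarkedStage.init X₀ x).W.presheaf.stalk (MarkedStage.init X₀ x).pt : Type) →+* R[X] ⧸ Ideal.span {h}),
      IsCPFrame (MarkedStage.init X₀ x) R u h φ ∧ IsAdicComplete (maximalIdeal R) R ∧
      ∀ i < h.natDegree, h.coeff i ∈ maximalIdeal R ^ (h.natDegree - i))
    {s : MarkedStage.{0}} (hs : Reaches R₀ 3 ν (MarkedStage.init X₀ x) s) :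
    ∃ (R : Type) (_ : CommRing R) (_ : IsLocalRing R) (u : Fin 3 → R) (h : R[X])
      (φ : (s.W.presheaf.stalk s.pt : Type) →+* R[X] ⧸ Ideal.span {h}),
      IsCPFrame s R u h φ ∧ IsAdicComplete (maximalIdeal R) R ∧
      ∀ i < h.natDegree, h.coeff i ∈ maximalIdeal R ^ (h.natDegree - i) := by
  refine exists_isCPFrame_of_reaches hRf hRa hX (fun s hs C P' hcs hH => ?_) h0 hs
  obtain ⟨R₁, _, _, u₁, h₁, φ₁, T, hF₁, hco₁, hJ, h00⟩ := hadapt s hs C P' hcs hH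
  exact ⟨R₁, inferInstance, u₁, h₁, φ₁, T, hF₁, hJ,
    hF₁.coeff_mem_pow_of_isPermissibleAt hco₁ C (hperm s hs C P' hcs) T hJ h00⟩

end Summit.ResolutionOfSingularities.ResolutionOfSingularities.Theorems.SigmaMaxModificationsCorridor3.Moving

end
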